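import Summits.BirchSwinnertonDyer.Rank1Residual.Ordinary.LocalDivExponentPointOrder
import Summits.BirchSwinnertonDyer.Rank1Residual.Ordinary.SylowExponentOneMultiplication
import Summits.BirchSwinnertonDyer.Rank1Residual.Ordinary.Conjectures.KuriharaExactOrderRankOneAt3
import HarnessLib

/-!
# The ONE-MULTIPLICATION test for `v_ℓ(P)`: `j ≤ v_ℓ(P) ⟺ (#Ẽ(𝔽_ℓ)/p^j)·P̄ = O` at a cyclic level, and
# `(#Ẽ(𝔽_ℓ)/p)·P̄ ≠ O ⟹ v_ℓ(P) = 0 ∧ the level is cyclic` at ANY good `ℓ ≠ p` (the instruments'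
# level-selection rule, PROVED)

HONEST FRAMING (cell `b2b-bsdres`, run/shared/lean/b2b/bsd-rank1-residual/, verbatim in every
file): the goal of the cell is to DELETE the COMBINATION-SHAPED residual classes of the
Birch–Swinnerton-Dyer formula for ALL analytic-rank `≤ 1` elliptic curves over `ℚ` — "full BSD
formula for every rank `≤ 1` curve in class `C`" assembled STRICTLY from published theorems — so
that the rank-`≤ 1` remainder becomes exactly the CONSTRUCTION-SHAPED classes, which are TYPED
(missing-input `Prop`s), NOT attempted. This is not "finishing BSD". Seat `b2b-bsdres-additive-p3`
(typer-designate for the cell conjecture C-16, hyp R-16 (e)). THEOREMS ONLY, about the VOCABULARY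
`localDivExponent` (`v_ℓ(P)`, `Ordinary/KuriharaExactOrderVocabulary.lean`) of the typed conjecture
C-16 = hyp §120 C120.1 (`Ordinary/Conjectures/KuriharaExactOrderRankOneAt3.lean`); nothing about any
particular curve is asserted, nothing is booked, no mark / label / count / tier moves; C-16 stays a
CONJECTURE (data-suggested, never theorem). Siblings: `Ordinary/CyclicSylowDivisibility.lean` and
`Ordinary/SylowExponentOneMultiplication.lean` (group theory), `Ordinary/LocalDivExponentPointOrder.lean`
(`v_ℓ(P) = e_ℓ − v_p(ord P̄)` at a cyclic level).

## Why this file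

The P-5 rounds (`HOME/b2b-bsdres-additive-p3/R1-DEPTH-LAW.md` §1, §4 (a)) and the consumer file
`Ordinary/Conjectures/KuriharaExactOrderRankOneAt3Partial.lean` select, per curve, cyclic Kolyvagin primes
`ℓ` with `v_ℓ(P) = 0` (a FLOOR reading wants them; the partial file's `∂^{(1)} = FLOOR` takes ONE such prime
as a hypothesis) and, for the law-discriminating levels, primes with `v_ℓ(P) = 1, 2`. The instruments decide
this with ONE scalar multiplication of the reduction `P̄ ∈ Ẽ(𝔽_ℓ)`: `v = 0` iff `(#Ẽ(𝔽_ℓ)/p)·P̄ ≠ O`, and in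
general `v_ℓ(P) = max {j ≤ e_ℓ : (#Ẽ(𝔽_ℓ)/p^j)·P̄ = O}`; equivalently they form the `p`-primary component
`Q = (#Ẽ(𝔽_ℓ)/p^{e_ℓ})·P̄`, read its order `p^t`, and set `v = e_ℓ − t`. This file PROVES that these
recipes compute the typed `localDivExponent W p ℓ P`:

* the group theory (`(#G/p^j) • x = 0 ⟺ v_p(ord x) + j ≤ e`; `(#G/p) • x ≠ 0 ⟺ v_p(ord x) = e`; the
  order of the `p`-primary component; `v_p(ord x) = e ⟹ #G[p] ≤ p`) is the sibling
  `Ordinary/SylowExponentOneMultiplication.lean`;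
* §2 (good `ℓ ≠ p`, `P̄` = the reduction of `P` read on the residue field of `ℤ_ℓ` exactly as in the
  siblings): WITHOUT any cyclicity hypothesis, `j ≤ v_ℓ(P) ⟹ (#Ẽ(𝔽_ℓ)/p^j)·P̄ = O`, hence
  **`(#Ẽ(𝔽_ℓ)/p)·P̄ ≠ O ⟹ v_ℓ(P) = 0`** (`localDivExponent_eq_zero_of_card_div_smul_reduction_ne_zero`) —
  the direction that CERTIFIES a designed `v = 0` level — and the same witness certifies the CYCLICITY of
  the level, `#Ẽ(𝔽_ℓ)[p] ≤ p` (`card_torsion_le_of_card_div_smul_reduction_ne_zero`, read on the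
  `ZMod ℓ`-points as in `IsCyclicKolyvaginLevel`); at a cyclic level the test is an EQUIVALENCE for every
  `j ≤ e_ℓ` (`le_localDivExponent_iff_card_div_pow_smul_reduction_eq_zero`), in particular
  **`v_ℓ(P) = 0 ⟺ (#Ẽ(𝔽_ℓ)/p)·P̄ ≠ O`** when `p ∣ #Ẽ(𝔽_ℓ)`, and `v_ℓ(P) = e_ℓ − v_p(ord Q)` for the
  `p`-primary component `Q` (`localDivExponent_eq_sub_padicValNat_addOrderOf_primary`).
* §3 (at the letter of C-16): for a Kolyvagin prime `ℓ ∈ 𝒫_k(E, p)`, `k ≥ 1` (`Kato.IsKolyvaginPrime`, so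
  `ℓ ∤ Np` and `p^k ∣ #Ẽ(𝔽_ℓ)`) on an elliptic globally minimal `W`: **`(#Ẽ(𝔽_ℓ)/p)·P̄ ≠ O ⟹
  IsCyclicKolyvaginLevel W p ℓ ∧ v_ℓ(P) = 0`** (`isCyclicKolyvaginLevel_and_localDivExponent_eq_zero`) — the
  two hypotheses `hcyc`, `hv` of C-16's consumer `kuriharaUnitPrimeAt_three_of_kuriharaExactOrderRankOne` and
  of the partial file's `∂^{(1)} = FLOOR` from ONE multiplication mod `ℓ`; and, given
  `IsCyclicKolyvaginLevel W p ℓ`, `v_ℓ(P) = 0 ⟺ (#Ẽ(𝔽_ℓ)/p)·P̄ ≠ O` with no further side condition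
  (`localDivExponent_eq_zero_iff_of_isKolyvaginPrime`).
* §4: the sibling consumer of C-16 restated with these decidable level hypotheses —
  `kuriharaUnitPrimeAt_three_of_kuriharaExactOrderRankOne_of_witness` (C-16 ⟹ `X4.KuriharaUnitPrimeAt W 3 D.f`
  on a FLOOR-`0` pair given ONE `ℓ ∈ 𝒫₁(E, 3)` with `(#Ẽ(𝔽_ℓ)/3)·P̄ ≠ O`; C-16 is a HYPOTHESIS there).

References: standard group theory; J. H. Silverman, AEC 2nd ed. (2009), VII.2.1 / IV.2.3 (reduction is
injective on prime-to-`ℓ` torsion and `P ∈ nE(ℚ_ℓ) ⟺ P̄ ∈ nẼ(𝔽_ℓ)`, used through the siblings)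
[SilvermanAEC2009]; C.-H. Kim, Amer. J. Math. 148 (2026) = arXiv:2203.12159, §1.2.2 (Kolyvagin primes)
[Kim2022StructureSelmer]; hyp `SHARPENED-CONJECTURES.md` §120 C120.1; additive-p3 `R1-DEPTH-LAW.md` §1, §4 (a), §5.
-/

noncomputable section

open scoped Classical

open WeierstrassCurve Literature.NumberTheory.EllipticCurves
  Literature.NumberTheory.EllipticCurves.ModularForms Literature.NumberTheory.EllipticCurves.Rank1Residual

namespace Summit.BirchSwinnertonDyer.Rank1Residual.Ordinary

/-! ### §2 The test for `v_ℓ(P)` on the reduction `P̄ ∈ Ẽ(𝔽_ℓ)` -/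

section Reduction

variable (W : WeierstrassCurve ℚ) [W.IsElliptic] [W.IsGloballyMinimal] (p ℓ : ℕ) [Fact p.Prime]
  [Fact ℓ.Prime]

omit [W.IsElliptic] in
/-- The residue-field points of the `ℤ_ℓ`-model form a finite group (of order `#Ẽ(𝔽_ℓ) ≠ 0`). [folklore] -/
private theorem finite_point_residue :
    Finite (((integralModelInt W).map (Int.castRingHom ℤ_[ℓ])).map
      (IsLocalRing.residue ℤ_[ℓ])).toAffine.Point :=
  Nat.finite_of_card_ne_zero (by
    rw [W.natCard_point_padicModel_residue ℓ]
    exact reductionPointCount_ne_zero W ℓ)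

/-- **`j ≤ v_ℓ(P) ⟹ (#Ẽ(𝔽_ℓ)/p^j) • P̄ = 0`** at a good prime `ℓ ≠ p`, with NO cyclicity hypothesis:
`v_ℓ(P) + v_p(ord P̄) ≤ e_ℓ` (sibling `localDivExponent_add_padicValNat_addOrderOf_reduction_le`) and
§1. [cite: SilvermanAEC2009, Prop. VII.2.1 and Prop. IV.2.3] -/
theorem card_div_pow_smul_reduction_eq_zero_of_le_localDivExponent
    (hgood : ¬ (ℓ : ℤ) ∣ minimalDiscriminantInt W) (hℓp : ℓ ≠ p) (P : W.toAffine.Point) {j : ℕ}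
    (hj : j ≤ localDivExponent W p ℓ P) :
    (W.reductionPointCount ℓ / p ^ j) •
      reducePoint ((integralModelInt W).map (Int.castRingHom ℤ_[ℓ]))
        (Affine.Point.congrEquiv (W.padicModel_baseChange ℓ).symm
          (Affine.Point.map (W' := W.toAffine) (Algebra.ofId ℚ ℚ_[ℓ]) P)) = 0 := by
  haveI := finite_point_residue W ℓ
  have hle := localDivExponent_add_padicValNat_addOrderOf_reduction_le W p ℓ hgood hℓp P
  have hcap := localDivExponent_le W p ℓ P
  rw [← W.natCard_point_padicModel_residue ℓ] at hle hcap ⊢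
  exact (card_div_pow_smul_eq_zero_iff (p := p) (hj.trans hcap) _).mpr (by omega)

/-- **`(#Ẽ(𝔽_ℓ)/p^j) • P̄ ≠ 0 ⟹ v_ℓ(P) < j`** at a good prime `ℓ ≠ p` (no cyclicity hypothesis).
[cite: SilvermanAEC2009, Prop. VII.2.1 and Prop. IV.2.3] -/
theorem localDivExponent_lt_of_card_div_pow_smul_reduction_ne_zero
    (hgood : ¬ (ℓ : ℤ) ∣ minimalDiscriminantInt W) (hℓp : ℓ ≠ p) (P : W.toAffine.Point) {j : ℕ}
    (h : (W.reductionPointCount ℓ / p ^ j) •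
      reducePoint ((integralModelInt W).map (Int.castRingHom ℤ_[ℓ]))
        (Affine.Point.congrEquiv (W.padicModel_baseChange ℓ).symm
          (Affine.Point.map (W' := W.toAffine) (Algebra.ofId ℚ ℚ_[ℓ]) P)) ≠ 0) :
    localDivExponent W p ℓ P < j := by
  by_contra hlt
  exact h (card_div_pow_smul_reduction_eq_zero_of_le_localDivExponent W p ℓ hgood hℓp P
    (not_lt.mp hlt))

/-- **THE CERTIFYING DIRECTION, no cyclicity needed: `(#Ẽ(𝔽_ℓ)/p) • P̄ ≠ 0 ⟹ v_ℓ(P) = 0`** at a good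
prime `ℓ ≠ p` — `P` is not `p`-divisible in `E(ℚ_ℓ)`; the instruments' designed "`v = 0` units / floors"
levels are certified by ONE scalar multiplication mod `ℓ`. [cite: SilvermanAEC2009, Prop. VII.2.1 and Prop. IV.2.3] -/
theorem localDivExponent_eq_zero_of_card_div_smul_reduction_ne_zero
    (hgood : ¬ (ℓ : ℤ) ∣ minimalDiscriminantInt W) (hℓp : ℓ ≠ p) (P : W.toAffine.Point)
    (h : (W.reductionPointCount ℓ / p) •
      reducePoint ((integralModelInt W).map (Int.castRingHom ℤ_[ℓ]))
        (Affine.Point.congrEquiv (W.padicModel_baseChange ℓ).symm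
          (Affine.Point.map (W' := W.toAffine) (Algebra.ofId ℚ ℚ_[ℓ]) P)) ≠ 0) :
    localDivExponent W p ℓ P = 0 := by
  have hlt := localDivExponent_lt_of_card_div_pow_smul_reduction_ne_zero W p ℓ hgood hℓp P (j := 1)
    (by rwa [pow_one])
  omega

omit [W.IsElliptic] in
/-- **… and the same witness certifies that the level is CYCLIC: `(#Ẽ(𝔽_ℓ)/p) • P̄ ≠ 0 ⟹ #Ẽ(𝔽_ℓ)[p] ≤ p`**
(`p ∣ #Ẽ(𝔽_ℓ)`; the `p`-primary component of `P̄` then generates the `p`-Sylow subgroup, sibling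
`card_torsion_le_of_card_div_smul_ne_zero`), read on the `ZMod ℓ`-points of the reduction exactly as in
the clause of `IsCyclicKolyvaginLevel` (transport by the sibling's
`natCard_torsion_residue_eq_natCard_torsion_zmod`). [folklore] -/
theorem card_torsion_le_of_card_div_smul_reduction_ne_zero (P : W.toAffine.Point)
    (he : 1 ≤ padicValNat p (W.reductionPointCount ℓ))
    (h : (W.reductionPointCount ℓ / p) •
      reducePoint ((integralModelInt W).map (Int.castRingHom ℤ_[ℓ]))
        (Affine.Point.congrEquiv (W.padicModel_baseChange ℓ).symm
          (Affine.Point.map (W' := W.toAffine) (Algebra.ofId ℚ ℚ_[ℓ]) P)) ≠ 0) :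
    Nat.card {Q : ((integralModelInt W).map (Int.castRingHom (ZMod ℓ))).toAffine.Point //
      p • Q = 0} ≤ p := by
  haveI := finite_point_residue W ℓ
  rw [← natCard_torsion_residue_eq_natCard_torsion_zmod W ℓ p]
  rw [← W.natCard_point_padicModel_residue ℓ] at he h
  exact card_torsion_le_of_card_div_smul_ne_zero he h

/-- **At a cyclic level the test is an equivalence: `j ≤ v_ℓ(P) ⟺ (#Ẽ(𝔽_ℓ)/p^j) • P̄ = 0`** for every
`j ≤ e_ℓ = v_p #Ẽ(𝔽_ℓ)`, at a good prime `ℓ ≠ p` with `#Ẽ(𝔽_ℓ)[p] ≤ p` (C-16's `IsCyclicKolyvaginLevel W p ℓ`);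
so `v_ℓ(P) = max {j ≤ e_ℓ : (#Ẽ(𝔽_ℓ)/p^j)·P̄ = O}`. From the sibling's
`v_ℓ(P) = e_ℓ − v_p(ord P̄)` and §1. [cite: SilvermanAEC2009, Prop. VII.2.1 and Prop. IV.2.3] -/
theorem le_localDivExponent_iff_card_div_pow_smul_reduction_eq_zero
    (hgood : ¬ (ℓ : ℤ) ∣ minimalDiscriminantInt W) (hℓp : ℓ ≠ p) (hcyc : IsCyclicKolyvaginLevel W p ℓ)
    (P : W.toAffine.Point) {j : ℕ} (hj : j ≤ padicValNat p (W.reductionPointCount ℓ)) :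
    j ≤ localDivExponent W p ℓ P ↔
      (W.reductionPointCount ℓ / p ^ j) •
        reducePoint ((integralModelInt W).map (Int.castRingHom ℤ_[ℓ]))
          (Affine.Point.congrEquiv (W.padicModel_baseChange ℓ).symm
            (Affine.Point.map (W' := W.toAffine) (Algebra.ofId ℚ ℚ_[ℓ]) P)) = 0 := by
  haveI := finite_point_residue W ℓ
  rw [localDivExponent_eq_of_isCyclicKolyvaginLevel W p ℓ hgood hℓp hcyc P]
  have hj' := hj
  rw [← W.natCard_point_padicModel_residue ℓ] at hj' ⊢
  rw [card_div_pow_smul_eq_zero_iff hj']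
  have := padicValNat_addOrderOf_le_padicValNat_card (p := p)
    (reducePoint ((integralModelInt W).map (Int.castRingHom ℤ_[ℓ]))
      (Affine.Point.congrEquiv (W.padicModel_baseChange ℓ).symm
        (Affine.Point.map (W' := W.toAffine) (Algebra.ofId ℚ ℚ_[ℓ]) P)))
  omega

/-- **`v_ℓ(P) = 0 ⟺ (#Ẽ(𝔽_ℓ)/p) • P̄ ≠ 0`** at a good cyclic level `ℓ ≠ p` with `p ∣ #Ẽ(𝔽_ℓ)` (every
Kolyvagin prime of depth `≥ 1`): the P-5 rounds' level-selection rule "`v = 0` primes by one point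
multiplication" computes the typed `localDivExponent`. [cite: SilvermanAEC2009, Prop. VII.2.1 and Prop. IV.2.3] -/
theorem localDivExponent_eq_zero_iff_card_div_smul_reduction_ne_zero
    (hgood : ¬ (ℓ : ℤ) ∣ minimalDiscriminantInt W) (hℓp : ℓ ≠ p) (hcyc : IsCyclicKolyvaginLevel W p ℓ)
    (P : W.toAffine.Point) (he : 1 ≤ padicValNat p (W.reductionPointCount ℓ)) :
    localDivExponent W p ℓ P = 0 ↔
      (W.reductionPointCount ℓ / p) •
        reducePoint ((integralModelInt W).map (Int.castRingHom ℤ_[ℓ]))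
          (Affine.Point.congrEquiv (W.padicModel_baseChange ℓ).symm
            (Affine.Point.map (W' := W.toAffine) (Algebra.ofId ℚ ℚ_[ℓ]) P)) ≠ 0 := by
  have h := le_localDivExponent_iff_card_div_pow_smul_reduction_eq_zero W p ℓ hgood hℓp hcyc P
    (j := 1) he
  rw [pow_one] at h
  constructor
  · intro h0 hQ
    have h1 := h.mpr hQ
    omega
  · intro hQ
    by_contra h0
    exact hQ (h.mp (by omega))

/-- **`v_ℓ(P) = e_ℓ − v_p(ord Q)` for the `p`-primary component `Q = (#Ẽ(𝔽_ℓ)/p^{e_ℓ}) • P̄`** at a good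
cyclic level `ℓ ≠ p` — the instruments' second recipe (form `Q`, read `ord Q = p^t`, `v = e_ℓ − t`)
computes the typed `localDivExponent`. [cite: SilvermanAEC2009, Prop. VII.2.1 and Prop. IV.2.3] -/
theorem localDivExponent_eq_sub_padicValNat_addOrderOf_primary
    (hgood : ¬ (ℓ : ℤ) ∣ minimalDiscriminantInt W) (hℓp : ℓ ≠ p) (hcyc : IsCyclicKolyvaginLevel W p ℓ)
    (P : W.toAffine.Point) :
    localDivExponent W p ℓ P = padicValNat p (W.reductionPointCount ℓ) -
      padicValNat p (addOrderOf ((W.reductionPointCount ℓ / p ^ padicValNat p (W.reductionPointCount ℓ)) •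
        reducePoint ((integralModelInt W).map (Int.castRingHom ℤ_[ℓ]))
          (Affine.Point.congrEquiv (W.padicModel_baseChange ℓ).symm
            (Affine.Point.map (W' := W.toAffine) (Algebra.ofId ℚ ℚ_[ℓ]) P)))) := by
  haveI := finite_point_residue W ℓ
  rw [localDivExponent_eq_of_isCyclicKolyvaginLevel W p ℓ hgood hℓp hcyc P,
    ← W.natCard_point_padicModel_residue ℓ, padicValNat_addOrderOf_card_div_pow_smul]

/-- Without cyclicity the second recipe still BOUNDS `v_ℓ(P)`: `v_ℓ(P) + v_p(ord Q) ≤ e_ℓ`.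
[cite: SilvermanAEC2009, Prop. VII.2.1 and Prop. IV.2.3] -/
theorem localDivExponent_add_padicValNat_addOrderOf_primary_le
    (hgood : ¬ (ℓ : ℤ) ∣ minimalDiscriminantInt W) (hℓp : ℓ ≠ p) (P : W.toAffine.Point) :
    localDivExponent W p ℓ P +
      padicValNat p (addOrderOf ((W.reductionPointCount ℓ / p ^ padicValNat p (W.reductionPointCount ℓ)) •
        reducePoint ((integralModelInt W).map (Int.castRingHom ℤ_[ℓ]))
          (Affine.Point.congrEquiv (W.padicModel_baseChange ℓ).symm
            (Affine.Point.map (W' := W.toAffine) (Algebra.ofId ℚ ℚ_[ℓ]) P)))) ≤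
      padicValNat p (W.reductionPointCount ℓ) := by
  haveI := finite_point_residue W ℓ
  have hle := localDivExponent_add_padicValNat_addOrderOf_reduction_le W p ℓ hgood hℓp P
  rw [← W.natCard_point_padicModel_residue ℓ] at hle ⊢
  rwa [padicValNat_addOrderOf_card_div_pow_smul]

end Reduction

/-! ### §3 At the letter of C-16: Kolyvagin primes `ℓ ∈ 𝒫_k(E, p)`, `k ≥ 1`, with cyclic `p`-torsion -/

section Letter

variable (W : WeierstrassCurve ℚ) [W.IsElliptic] [W.IsGloballyMinimal] (p ℓ : ℕ) [Fact p.Prime]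
  [Fact ℓ.Prime]

omit [Fact p.Prime] in
/-- A Kolyvagin prime `ℓ ∈ 𝒫_k(E, p)` (`ℓ ∤ Np`) is a prime of good reduction: `ℓ ∤ Δ_min(E)`.
[cite: Kim2022StructureSelmer, §1.2.2] -/
theorem not_dvd_minimalDiscriminantInt_of_isKolyvaginPrime {k : ℕ}
    (hℓ : Kato.IsKolyvaginPrime W p k ℓ) : ¬ (ℓ : ℤ) ∣ minimalDiscriminantInt W := by
  have hgood : W.HasGoodReductionAtPrime ℓ := by
    by_contra hbad
    exact hℓ.not_dvd_conductorNorm ((W.dvd_conductorNorm_iff_not_hasGoodReductionAtPrime ℓ).mpr hbad)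
  exact not_dvd_minimalDiscriminantInt_of_hasGoodReductionAtPrime' W ℓ hgood

/-- **ONE multiplication mod `ℓ` certifies BOTH level clauses at once: at a Kolyvagin prime
`ℓ ∈ 𝒫_k(E, p)`, `k ≥ 1`, `(#Ẽ(𝔽_ℓ)/p) • P̄ ≠ 0 ⟹ IsCyclicKolyvaginLevel W p ℓ ∧ v_ℓ(P) = 0`** — the
`p`-primary component of `P̄` generates the `p`-Sylow subgroup of `Ẽ(𝔽_ℓ)`, so the level is cyclic, and
`P` is not `p`-divisible in `E(ℚ_ℓ)`. These are exactly the hypotheses `hcyc`, `hv` of C-16's consumer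
`kuriharaUnitPrimeAt_three_of_kuriharaExactOrderRankOne` and of the partial file's `∂^{(1)} = FLOOR`
(`ℓ ∈ 𝒫₁` is `IsKolyvaginPrime.mono`; a prime is square-free). [cite: Kim2022StructureSelmer, §1.2.2] -/
theorem isCyclicKolyvaginLevel_and_localDivExponent_eq_zero {k : ℕ} (hk : 1 ≤ k)
    (hℓ : Kato.IsKolyvaginPrime W p k ℓ) (P : W.toAffine.Point)
    (h : (W.reductionPointCount ℓ / p) •
      reducePoint ((integralModelInt W).map (Int.castRingHom ℤ_[ℓ]))
        (Affine.Point.congrEquiv (W.padicModel_baseChange ℓ).symm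
          (Affine.Point.map (W' := W.toAffine) (Algebra.ofId ℚ ℚ_[ℓ]) P)) ≠ 0) :
    IsCyclicKolyvaginLevel W p ℓ ∧ localDivExponent W p ℓ P = 0 := by
  have hℓp : ℓ.Prime := Fact.out
  have he : 1 ≤ padicValNat p (W.reductionPointCount ℓ) := by
    have hk' : k ≤ padicValNat p (W.reductionPointCount ℓ) :=
      (padicValNat_dvd_iff_le (reductionPointCount_ne_zero W ℓ)).mp hℓ.pow_dvd_reductionPointCount
    omega
  refine ⟨⟨⟨hℓp.prime.squarefree, fun q hq => ?_⟩, fun q _ hq => ?_⟩,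
    localDivExponent_eq_zero_of_card_div_smul_reduction_ne_zero W p ℓ
      (not_dvd_minimalDiscriminantInt_of_isKolyvaginPrime W p ℓ hℓ) hℓ.ne P h⟩
  · rw [Nat.Prime.primeFactors hℓp, Finset.mem_singleton] at hq
    subst hq
    exact hℓ.mono hk
  · obtain rfl : q = ℓ := (Nat.prime_dvd_prime_iff_eq Fact.out hℓp).mp hq
    exact card_torsion_le_of_card_div_smul_reduction_ne_zero W p q P he h

/-- **On C-16's letter: at a Kolyvagin prime `ℓ ∈ 𝒫_k(E, p)`, `k ≥ 1`, with `IsCyclicKolyvaginLevel W p ℓ`,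
`v_ℓ(P) = 0 ⟺ (#Ẽ(𝔽_ℓ)/p) • P̄ ≠ 0`** — no further side condition (`ℓ ≠ p`, `ℓ ∤ Δ_min` and
`p ∣ #Ẽ(𝔽_ℓ)` all follow from `ℓ ∈ 𝒫_k`, `IsKolyvaginPrime.ne` / `.not_dvd_conductorNorm` /
`.pow_dvd_reductionPointCount`). This is the hypothesis `localDivExponent W 3 ℓ P = 0` of
`kuriharaUnitPrimeAt_three_of_kuriharaExactOrderRankOne` and of the partial file's `∂^{(1)} = FLOOR`,
made decidable by one multiplication mod `ℓ`. [cite: Kim2022StructureSelmer, §1.2.2] -/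
theorem localDivExponent_eq_zero_iff_of_isKolyvaginPrime {k : ℕ} (hk : 1 ≤ k)
    (hℓ : Kato.IsKolyvaginPrime W p k ℓ) (hcyc : IsCyclicKolyvaginLevel W p ℓ) (P : W.toAffine.Point) :
    localDivExponent W p ℓ P = 0 ↔
      (W.reductionPointCount ℓ / p) •
        reducePoint ((integralModelInt W).map (Int.castRingHom ℤ_[ℓ]))
          (Affine.Point.congrEquiv (W.padicModel_baseChange ℓ).symm
            (Affine.Point.map (W' := W.toAffine) (Algebra.ofId ℚ ℚ_[ℓ]) P)) ≠ 0 := by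
  have hpp : p.Prime := Fact.out
  have he : 1 ≤ padicValNat p (W.reductionPointCount ℓ) := by
    have hdvd : p ^ k ∣ W.reductionPointCount ℓ := hℓ.pow_dvd_reductionPointCount
    have hk' : k ≤ padicValNat p (W.reductionPointCount ℓ) :=
      (padicValNat_dvd_iff_le (reductionPointCount_ne_zero W ℓ)).mp hdvd
    omega
  exact localDivExponent_eq_zero_iff_card_div_smul_reduction_ne_zero W p ℓ
    (not_dvd_minimalDiscriminantInt_of_isKolyvaginPrime W p ℓ hℓ) hℓ.ne hcyc P he

/-- **… and `j ≤ v_ℓ(P) ⟺ (#Ẽ(𝔽_ℓ)/p^j) • P̄ = 0` for every `j ≤ k`** at such a prime (`p^k ∣ #Ẽ(𝔽_ℓ)`):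
the law-discriminating designed levels (`v_ℓ(P) = 1, 2`) are selected by the same test.
[cite: Kim2022StructureSelmer, §1.2.2] -/
theorem le_localDivExponent_iff_of_isKolyvaginPrime {k : ℕ}
    (hℓ : Kato.IsKolyvaginPrime W p k ℓ) (hcyc : IsCyclicKolyvaginLevel W p ℓ) (P : W.toAffine.Point)
    {j : ℕ} (hj : j ≤ k) :
    j ≤ localDivExponent W p ℓ P ↔
      (W.reductionPointCount ℓ / p ^ j) •
        reducePoint ((integralModelInt W).map (Int.castRingHom ℤ_[ℓ]))
          (Affine.Point.congrEquiv (W.padicModel_baseChange ℓ).symm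
            (Affine.Point.map (W' := W.toAffine) (Algebra.ofId ℚ ℚ_[ℓ]) P)) = 0 := by
  have hk' : k ≤ padicValNat p (W.reductionPointCount ℓ) :=
    (padicValNat_dvd_iff_le (reductionPointCount_ne_zero W ℓ)).mp hℓ.pow_dvd_reductionPointCount
  exact le_localDivExponent_iff_card_div_pow_smul_reduction_eq_zero W p ℓ
    (not_dvd_minimalDiscriminantInt_of_isKolyvaginPrime W p ℓ hℓ) hℓ.ne hcyc P (hj.trans hk')

end Letter

/-! ### §4 C-16's consumer with decidable level hypotheses -/

section Consumer

/-- **C-16 ⟹ `X4.KuriharaUnitPrimeAt W 3 D.f` on every FLOOR-`0` pair of its letter having a Kolyvagin prime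
`ℓ ∈ 𝒫₁(E, 3)` with `(#Ẽ(𝔽_ℓ)/3) • P̄ ≠ 0`** — the sibling consumer
`kuriharaUnitPrimeAt_three_of_kuriharaExactOrderRankOne` with its two level hypotheses
`IsCyclicKolyvaginLevel W 3 ℓ` and `localDivExponent W 3 ℓ P = 0` replaced by the ONE multiplication mod `ℓ`
that certifies both (§3). C-16 is the HYPOTHESIS `hC` (a CONJECTURE; nothing asserted); at `p = 3` the
input's consumers stay conditional on the cell's OPEN Kim-2025@3 binder; nothing is booked.
[cite: Kim2022StructureSelmer, Thm. 1.9 (1)/(6) and §1.4.3 (PDF pp. 7–8)] -/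
theorem kuriharaUnitPrimeAt_three_of_kuriharaExactOrderRankOne_of_witness
    (hC : KuriharaExactOrderRankOneAtThree)
    (W : WeierstrassCurve ℚ) [W.IsElliptic] [W.IsGloballyMinimal] (hr : W.analyticRank = 1)
    (P : W.toAffine.Point) (hP : ¬ IsOfFinAddOrder P)
    (hgen : ∀ Q : W.toAffine.Point, ∃ n : ℤ, IsOfFinAddOrder (Q - n • P))
    (htors : ∀ T : W.toAffine.Point, 3 • T = 0 → T = 0) (hsurj : W.HasSurjectiveModNGaloisRep 3)
    (hgood : W.HasGoodReductionAtPrime 3) (ha1 : W.frobeniusTrace 3 ≠ 1) (ha2 : W.frobeniusTrace 3 ≠ -2)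
    (hm : ¬ O5.PointLocallyThreeDivisibleAt W 3 P) {q : ℚ} (hq : shaAn W = (q : ℂ))
    (hq0 : padicValRat 3 q = 0) (htam : ¬ 3 ∣ W.tamagawaProduct) {N : ℕ} [NeZero N]
    (D : ModularParametrizationData W N) (hc : ¬ (3 : ℤ) ∣ D.maninConstant)
    (hper : ∃ u : ℚ, ‖(u : ℚ_[3])‖ = 1 ∧ W.realPeriodRat = u * plusPeriod D.f)
    (ℓ : ℕ) [Fact ℓ.Prime] (hℓ : Kato.IsKolyvaginPrime W 3 1 ℓ)
    (hwit : (W.reductionPointCount ℓ / 3) •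
      reducePoint ((integralModelInt W).map (Int.castRingHom ℤ_[ℓ]))
        (Affine.Point.congrEquiv (W.padicModel_baseChange ℓ).symm
          (Affine.Point.map (W' := W.toAffine) (Algebra.ofId ℚ ℚ_[ℓ]) P)) ≠ 0) :
    X4.KuriharaUnitPrimeAt W 3 D.f := by
  haveI : Fact (Nat.Prime 3) := ⟨Nat.prime_three⟩
  obtain ⟨hcyc, hv⟩ := isCyclicKolyvaginLevel_and_localDivExponent_eq_zero W 3 ℓ le_rfl hℓ P hwit
  exact kuriharaUnitPrimeAt_three_of_kuriharaExactOrderRankOne hC W hr P hP hgen htors hsurj hgood ha1 ha2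
    hm hq hq0 htam D hc hper ℓ hℓ hcyc hv

end Consumer

end Summit.BirchSwinnertonDyer.Rank1Residual.Ordinary

end
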